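import Summits.AtomisticToContinuum.HydrodynamicLimit.Theorems.CollisionIsometryCLTDiffuseBackwardInfluenceSupersatDefs
import HarnessLib

/-!
# The occupation-time bound `T_max` for two fast sticks
(crux `DiffuseBackwardInfluence`, stmt-AtomisticToContinuum-12950, line `share-nondegeneracy-one-flight`;
registered sub-goal `occ_fast_bound` of `stub_stickLD`)

Two straight sticks `r ↦ x + r v`, `r ↦ x' + r v'` on the unit flat torus `𝕋³` with relative speed
`‖v - v'‖ ≥ w₀ > 0` are at minimal-image distance `< ε` during `[0, τ]` for a set of times of Lebesgue measure
at most `2ε (τ + 2√3 / w₀)`: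

* some coordinate `i` of `b := v - v'` has `|bᵢ| ≥ w₀ / √3` (`‖b‖² = ∑ᵢ bᵢ²`, `exists_coord_abs_ge`);
* minimal-image distance `< ε` forces `‖(a + r b)ᵢ‖_{ℝ/ℤ} < ε` (`|reprSym y i| = ‖y i‖ ≤ ‖reprSym y‖`), and
  `(posAt r z - posAt r z') i = α + bᵢ r (mod 1)` for a real lift `α` of `(x - x')ᵢ` (`posAt_sub_posAt_apply`);
* the affine change of variables `u = α + bᵢ r` (`Real.volume_preimage_mul_left`, `measure_preimage_add`) turns
  the one-coordinate set into `|bᵢ|⁻¹ ·` the measure of `{u ∈ J : ‖u‖_{ℝ/ℤ} < ε}` for an interval `J` of length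
  `|bᵢ| τ` (`volume_affine_window_le`);
* `J` is covered by `⌈|bᵢ| τ⌉₊ + 1 ≤ |bᵢ| τ + 2` unit windows `(t, t + 1]`, on each of which the quotient map is
  measure preserving (`UnitAddCircle.measurePreserving_mk`), so each contributes at most
  `volume (closedBall (0 : ℝ/ℤ) ε) = min 1 (2ε) ≤ 2ε` (`AddCircle.volume_closedBall`; `volume_Ioc_norm_coe_lt_le`,
  `volume_Icc_norm_coe_lt_le`).

Hence `occ ε τ z z' ≤ |bᵢ|⁻¹ (|bᵢ| τ + 2) 2ε = 2ε (τ + 2 / |bᵢ|) ≤ 2ε (τ + 2√3 / w₀)`.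
-/

namespace Summit.AtomisticToContinuum.HydrodynamicLimit.Theorems.DiffuseBackwardInfluenceShare

open scoped BigOperators Topology ENNReal Classical
open Filter Set MeasureTheory
open Literature.Analysis.FluidPDE
open Summit.AtomisticToContinuum.HydrodynamicLimit.Theorems.DiffuseBackwardInfluenceNeg

noncomputable section

namespace FewIdle

namespace Supersat

/-- One unit window: the set of `u ∈ (t, t + 1]` whose class in `ℝ/ℤ` has norm `< ε` has Lebesgue measure at most
`2ε` (push forward by the measure-preserving quotient map to the ball of radius `ε` in `ℝ/ℤ`, of Haar measure
`min 1 (2ε)`). [folklore] -/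
theorem volume_Ioc_norm_coe_lt_le (t ε : ℝ) :
    volume (Ioc t (t + 1) ∩ {u : ℝ | ‖((u : ℝ) : UnitAddCircle)‖ < ε}) ≤ ENNReal.ofReal (2 * ε) := by
  have hpre : {u : ℝ | ‖((u : ℝ) : UnitAddCircle)‖ < ε} = ((↑) : ℝ → UnitAddCircle) ⁻¹' Metric.ball 0 ε := by
    ext u; simp
  rw [inter_comm, ← Measure.restrict_apply' measurableSet_Ioc, hpre,
    (UnitAddCircle.measurePreserving_mk t).measure_preimage measurableSet_ball.nullMeasurableSet]
  calc volume (Metric.ball (0 : UnitAddCircle) ε) ≤ volume (Metric.closedBall (0 : UnitAddCircle) ε) :=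
        measure_mono Metric.ball_subset_closedBall
    _ = ENNReal.ofReal (min 1 (2 * ε)) := AddCircle.volume_closedBall 1 ε
    _ ≤ ENNReal.ofReal (2 * ε) := ENNReal.ofReal_le_ofReal (min_le_right _ _)

/-- A window of length `L`: the set of `u ∈ [A, A + L]` whose class in `ℝ/ℤ` has norm `< ε` has Lebesgue measure
at most `(L + 2) 2ε` (cover `[A, A + L]` by the `⌈L⌉₊ + 1 ≤ L + 2` unit windows `(A - 1 + n, A + n]`). [folklore] -/
theorem volume_Icc_norm_coe_lt_le {A L : ℝ} (ε : ℝ) (hL : 0 ≤ L) :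
    volume {u : ℝ | u ∈ Icc A (A + L) ∧ ‖((u : ℝ) : UnitAddCircle)‖ < ε} ≤
      ENNReal.ofReal ((L + 2) * (2 * ε)) := by
  have hcover : {u : ℝ | u ∈ Icc A (A + L) ∧ ‖((u : ℝ) : UnitAddCircle)‖ < ε} ⊆
      ⋃ n ∈ Finset.range (⌈L⌉₊ + 1),
        (Ioc (A - 1 + n) (A - 1 + n + 1) ∩ {u : ℝ | ‖((u : ℝ) : UnitAddCircle)‖ < ε}) := by
    rintro u ⟨⟨hAu, huA⟩, hu⟩
    refine mem_iUnion₂.2 ⟨⌈u - A⌉₊, Finset.mem_range.2 ?_, ⟨?_, ?_⟩, hu⟩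
    · exact Nat.lt_succ_of_le (Nat.ceil_mono (by linarith))
    · have := Nat.ceil_lt_add_one (show 0 ≤ u - A by linarith); linarith
    · have := Nat.le_ceil (u - A); linarith
  calc volume {u : ℝ | u ∈ Icc A (A + L) ∧ ‖((u : ℝ) : UnitAddCircle)‖ < ε}
      ≤ volume (⋃ n ∈ Finset.range (⌈L⌉₊ + 1),
          (Ioc (A - 1 + n) (A - 1 + n + 1) ∩ {u : ℝ | ‖((u : ℝ) : UnitAddCircle)‖ < ε})) := measure_mono hcover
    _ ≤ ∑ n ∈ Finset.range (⌈L⌉₊ + 1),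
          volume (Ioc (A - 1 + n) (A - 1 + n + 1) ∩ {u : ℝ | ‖((u : ℝ) : UnitAddCircle)‖ < ε}) :=
        measure_biUnion_finset_le _ _
    _ ≤ ∑ _n ∈ Finset.range (⌈L⌉₊ + 1), ENNReal.ofReal (2 * ε) :=
        Finset.sum_le_sum fun n _ => volume_Ioc_norm_coe_lt_le _ ε
    _ = ((⌈L⌉₊ + 1 : ℕ) : ℝ≥0∞) * ENNReal.ofReal (2 * ε) := by
        rw [Finset.sum_const, Finset.card_range, nsmul_eq_mul]
    _ ≤ ENNReal.ofReal ((L + 2) * (2 * ε)) := by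
        rw [ENNReal.ofReal_mul (show (0 : ℝ) ≤ L + 2 by positivity), ← ENNReal.ofReal_natCast]
        refine mul_le_mul' (ENNReal.ofReal_le_ofReal ?_) le_rfl
        have := Nat.ceil_lt_add_one hL
        push_cast; linarith

/-- The affine change of variables `u = α + c r` (`c > 0`): the set of `r ∈ [0, τ]` with `‖α + c r‖_{ℝ/ℤ} < ε` has
Lebesgue measure at most `c⁻¹ (c τ + 2) 2ε = 2ε (τ + 2 / c)`. [folklore] -/
theorem volume_affine_window_le {α c τ : ℝ} (ε : ℝ) (hc : 0 < c) (hτ : 0 ≤ τ) :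
    volume {r : ℝ | r ∈ Icc (0 : ℝ) τ ∧ ‖((α + c * r : ℝ) : UnitAddCircle)‖ < ε} ≤
      ENNReal.ofReal (2 * ε * (τ + 2 / c)) := by
  have hsub : {r : ℝ | r ∈ Icc (0 : ℝ) τ ∧ ‖((α + c * r : ℝ) : UnitAddCircle)‖ < ε} ⊆
      (fun r => c * r) ⁻¹' ((fun u => α + u) ⁻¹'
        {u : ℝ | u ∈ Icc α (α + c * τ) ∧ ‖((u : ℝ) : UnitAddCircle)‖ < ε}) := by
    rintro r ⟨⟨h0, hrτ⟩, hr⟩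
    exact ⟨⟨by nlinarith, by nlinarith⟩, hr⟩
  calc volume {r : ℝ | r ∈ Icc (0 : ℝ) τ ∧ ‖((α + c * r : ℝ) : UnitAddCircle)‖ < ε}
      ≤ volume ((fun r => c * r) ⁻¹' ((fun u => α + u) ⁻¹'
          {u : ℝ | u ∈ Icc α (α + c * τ) ∧ ‖((u : ℝ) : UnitAddCircle)‖ < ε})) := measure_mono hsub
    _ = ENNReal.ofReal c⁻¹ * volume {u : ℝ | u ∈ Icc α (α + c * τ) ∧ ‖((u : ℝ) : UnitAddCircle)‖ < ε} := by
        rw [Real.volume_preimage_mul_left hc.ne', measure_preimage_add, abs_of_pos (inv_pos.2 hc)]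
    _ ≤ ENNReal.ofReal c⁻¹ * ENNReal.ofReal ((c * τ + 2) * (2 * ε)) :=
        mul_le_mul' le_rfl (volume_Icc_norm_coe_lt_le ε (by positivity))
    _ = ENNReal.ofReal (2 * ε * (τ + 2 / c)) := by
        rw [← ENNReal.ofReal_mul (inv_pos.2 hc).le]
        congr 1
        field_simp

/-- Pigeonhole on coordinates: a vector of `ℝ³` of Euclidean norm `≥ w₀` has a coordinate of absolute value
`≥ w₀ / √3` (`‖b‖² = ∑ᵢ |bᵢ|² ≤ 3 maxᵢ |bᵢ|²`). [folklore] -/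
theorem exists_coord_abs_ge {w₀ : ℝ} (hw₀ : 0 < w₀) (b : V3) (hb : w₀ ≤ ‖b‖) :
    ∃ i : Fin 3, w₀ / Real.sqrt 3 ≤ |b i| := by
  by_contra h
  push Not at h
  have h3 : (w₀ / Real.sqrt 3) ^ 2 = w₀ ^ 2 / 3 := by
    rw [div_pow, Real.sq_sqrt (by norm_num)]
  have hlt : ∀ i, ‖b i‖ ^ 2 < w₀ ^ 2 / 3 := fun i => by
    rw [← h3, Real.norm_eq_abs]
    exact pow_lt_pow_left₀ (h i) (abs_nonneg _) two_ne_zero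
  have hsq : ‖b‖ ^ 2 < w₀ ^ 2 := by
    rw [EuclideanSpace.norm_sq_eq, Fin.sum_univ_three]
    linarith [hlt 0, hlt 1, hlt 2]
  have : w₀ ^ 2 ≤ ‖b‖ ^ 2 := pow_le_pow_left₀ hw₀.le hb 2
  linarith

/-- The `i`-th coordinate of the relative position of two straight sticks is affine mod 1:
`(posAt r z - posAt r z') i = α + (v - v')ᵢ r (mod 1)` for any real lift `α` of `(x - x')ᵢ`. [folklore] -/
theorem posAt_sub_posAt_apply (r : ℝ) (z z' : T3 × V3) (i : Fin 3) {α : ℝ}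
    (hα : ((α : ℝ) : UnitAddCircle) = (z.1 - z'.1) i) :
    (posAt r z - posAt r z') i = ((α + (z.2 - z'.2) i * r : ℝ) : UnitAddCircle) := by
  simp only [posAt, Pi.sub_apply, Pi.add_apply, Literature.Analysis.FunctionSpaces.Torus.proj_smul_apply,
    PiLp.sub_apply]
  rw [Pi.sub_apply] at hα
  have h : α + (z.2 i - z'.2 i) * r = α + (r * z.2 i - r * z'.2 i) := by ring
  rw [h, AddCircle.coe_add, AddCircle.coe_sub, hα]
  abel

/-- A coordinate of the relative position is dominated by the minimal-image distance:
`‖(y - y') i‖_{ℝ/ℤ} = |reprSym (y - y') i| ≤ ‖reprSym (y - y')‖ = euclidDist y y'`. [folklore] -/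
theorem norm_sub_apply_le_euclidDist (y y' : T3) (i : Fin 3) : ‖(y - y') i‖ ≤ Torus.euclidDist y y' := by
  rw [Torus.euclidDist_eq, ← Torus.abs_reprSym_apply, ← Real.norm_eq_abs]
  exact PiLp.norm_apply_le _ _

end Supersat

end FewIdle

open FewIdle.Supersat in
/-- **Occupation-time bound `T_max`** (registered sub-goal `occ_fast_bound` of `stub_stickLD`): two straight sticks on
`𝕋³` with relative speed `‖v - v'‖ ≥ w₀ > 0` are at minimal-image distance `< ε` during `[0, τ]` for a set of times
of Lebesgue measure at most `2ε (τ + 2√3 / w₀)`. Reduce to the coordinate `i` with `|(v - v')ᵢ| ≥ w₀/√3`, where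
the relative position is `α + (v - v')ᵢ r (mod 1)`, change variables affinely and count unit windows
(`volume_affine_window_le`). [folklore] -/
theorem occ_fast_bound : ∀ (ε τ w₀ : ℝ), 0 < ε → 0 ≤ τ → 0 < w₀ → ∀ z z' : T3 × V3, w₀ ≤ ‖z.2 - z'.2‖ → FewIdle.Supersat.occ ε τ z z' ≤ ENNReal.ofReal (2 * ε * (τ + 2 * Real.sqrt 3 / w₀)) := by
  intro ε τ w₀ hε hτ hw₀ z z' hzw
  obtain ⟨i, hi⟩ := exists_coord_abs_ge hw₀ (z.2 - z'.2) hzw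
  obtain ⟨α₀, hα₀⟩ : ∃ α₀ : ℝ, ((α₀ : ℝ) : UnitAddCircle) = (z.1 - z'.1) i :=
    QuotientAddGroup.mk_surjective _
  have h3 : 0 < Real.sqrt 3 := Real.sqrt_pos.2 (by norm_num)
  -- normalise the sign of the relative velocity coordinate
  obtain ⟨α, c, hc, hcoord⟩ : ∃ α c : ℝ, w₀ / Real.sqrt 3 ≤ c ∧
      ∀ r, ‖(posAt r z - posAt r z') i‖ = ‖((α + c * r : ℝ) : UnitAddCircle)‖ := by
    rcases le_or_gt 0 ((z.2 - z'.2) i) with h0 | h0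
    · exact ⟨α₀, (z.2 - z'.2) i, by rwa [abs_of_nonneg h0] at hi, fun r => by
        rw [posAt_sub_posAt_apply r z z' i hα₀]⟩
    · refine ⟨-α₀, -(z.2 - z'.2) i, by rwa [abs_of_neg h0] at hi, fun r => ?_⟩
      rw [posAt_sub_posAt_apply r z z' i hα₀, ← norm_neg, ← AddCircle.coe_neg]
      congr 2
      ring
  have hc0 : 0 < c := lt_of_lt_of_le (div_pos hw₀ h3) hc
  have hsub : {r : ℝ | r ∈ Icc (0 : ℝ) τ ∧ Torus.euclidDist (posAt r z) (posAt r z') < ε} ⊆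
      {r : ℝ | r ∈ Icc (0 : ℝ) τ ∧ ‖((α + c * r : ℝ) : UnitAddCircle)‖ < ε} := by
    rintro r ⟨hr, hd⟩
    refine ⟨hr, ?_⟩
    rw [← hcoord r]
    exact (norm_sub_apply_le_euclidDist _ _ i).trans_lt hd
  calc occ ε τ z z' ≤ volume {r : ℝ | r ∈ Icc (0 : ℝ) τ ∧ ‖((α + c * r : ℝ) : UnitAddCircle)‖ < ε} :=
        measure_mono hsub
    _ ≤ ENNReal.ofReal (2 * ε * (τ + 2 / c)) := volume_affine_window_le ε hc0 hτ
    _ ≤ ENNReal.ofReal (2 * ε * (τ + 2 * Real.sqrt 3 / w₀)) := by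
        refine ENNReal.ofReal_le_ofReal (mul_le_mul_of_nonneg_left ?_ (by positivity))
        have hcw : 2 / c ≤ 2 * Real.sqrt 3 / w₀ := by
          rw [div_le_div_iff₀ hc0 hw₀]
          rw [div_le_iff₀ h3] at hc
          nlinarith
        linarith

end

end Summit.AtomisticToContinuum.HydrodynamicLimit.Theorems.DiffuseBackwardInfluenceShare
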